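import Summits.QuantumFields.YangMills.Theses.SqueezedSkewness
import Summits.QuantumFields.YangMills.Theorems.SqueezedSkewnessTorusFloorsGlue
import Summits.QuantumFields.YangMills.Theorems.SqueezedSkewnessKLCoherence
import Summits.QuantumFields.YangMills.Theorems.SqueezedSkewnessDivisibleBump

/-!
# Birth skeleton — BOTH registered decompositions (LINE χ «chord escalator», LINE α «low-pass + antipodal ceiling») of the node
# `PointlikeHypercubeFloors` (stmt-QuantumFields-23205); one registration keeps the stubs of both lines active
# (planner ym-idea-6 g12, lens oqh; route-QuantumFields-SqueezedSkewness rev 18)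

THE LINE.  `TorusKL` (23204) writes the reflection covariance of the symmetric hypercube `(2L+1)⁴` as a POSITIVE mixture
`Qrp(f) = Σ_n W_n ‖amp f(μ_n, p_n)‖²` (`W_n, μ_n ≥ 0`, image atoms `μ > 1` and thermal atoms included) in which a lattice
time-shift of the test function by `m` steps multiplies `amp` by `μ^m`.  Hence `m ↦ log Qrp(v shifted down by m steps)` is CONVEX
(Lyapunov/Jensen) — the CHORD ESCALATOR (`ChordEscalator`, support M): a femto FLOOR `ε ≤ Qrp(f₁)` for a translate at femto
height `~2h₁` and a femto CEILING `Qrp(g) ≤ C` for the translate at femto height `~h₁` force `ε^A/C^A ≤ Qrp(v)` at height `~1`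
(`A = ⌈2δ₁/h₁⌉`), β- and volume-uniformly, with NO infrared input (no spectral gap, purity, thermal fraction, low-pass
projection, period descent).  The floor is the crux `FemtoFloorUnit` (r7, XL: a unit carrying the spine's `FBL6` and the femto
bump floors for every radius — the spine's femto two-point package minus `FC3`); the ceiling is `FemtoCeiling` (support M/L:
`FBL6 ⇒ MomentBounds6` by the LANDED `DlrCollarTransfer.stub_collar6`, then an `a`-uniform pair count).  The composition
`PointlikeHypercubeFloors_of` below is KERNEL-CHECKED (no sorry of its own) and is the content of the route item `ChordFloorsGlue`.
The sibling decomposition of the same node is LINE α (`Lines/pointlike_lowpass_birth.lean`: LowPassFloorH, AntipodalMirrorCeiling,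
TorusKL through `TorusFloorsGlue ✓`).  Sorries: exactly the six stubs (four of LINE χ, two more of LINE α; `stub_torusKL` is shared).  No NT / summit statement is proved here. [folklore]
-/

set_option autoImplicit false

noncomputable section

namespace Summit.QuantumFields.YangMills.Cruxes.NT.PointlikeNodeBirth

open Summit.QuantumFields.YangMills.Theses.SqueezedSkewness

namespace __Registered

/-- = `SqueezedSkewness.FemtoFloorUnit` (crux r7, rev 18) BY NAME. -/
abbrev stub_femtoFloorUnit : Prop :=
  Summit.QuantumFields.YangMills.Theses.SqueezedSkewness.FemtoFloorUnit

/-- = `SqueezedSkewness.TorusKL` (stmt-QuantumFields-23204, crux r5) BY NAME — feeds `stub_chordEscalator`. -/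
abbrev stub_torusKL : Prop :=
  Summit.QuantumFields.YangMills.Theses.SqueezedSkewness.TorusKL

/-- = `SqueezedSkewness.ChordEscalator` (support, rev 18) BY NAME: `TorusKL → (Lyapunov chord inequality for lattice translates)`. -/
abbrev stub_chordEscalator : Prop :=
  Summit.QuantumFields.YangMills.Theses.SqueezedSkewness.ChordEscalator

/-- = `SqueezedSkewness.FemtoCeiling` (support, rev 18) BY NAME: `FBL6 ⇒` ceilings for femto-height translates. -/
abbrev stub_femtoCeiling : Prop :=
  Summit.QuantumFields.YangMills.Theses.SqueezedSkewness.FemtoCeiling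

/-- = `SqueezedSkewness.LowPassFloorH` (stmt-QuantumFields-23201, crux r2) BY NAME — LINE α. -/
abbrev stub_lowPassFloorH : Prop :=
  Summit.QuantumFields.YangMills.Theses.SqueezedSkewness.LowPassFloorH

/-- = `SqueezedSkewness.AntipodalMirrorCeiling` (stmt-QuantumFields-23202, crux r3, split 23389/23390/23391) BY NAME — LINE α. -/
abbrev stub_antipodalMirrorCeiling : Prop :=
  Summit.QuantumFields.YangMills.Theses.SqueezedSkewness.AntipodalMirrorCeiling

end __Registered

/-- stub (crux r7, XL — the hardest): FEMTO FLOOR UNIT. OPEN. Route of proof: the physical unit of the spine (`stub_pin`), `FBL6`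
there (engine), and the femto bump floors from `FC2 ∧ FBL` by the law of total covariance exactly as in the landed
`DlrCollarTransfer.stub_lower` clause (i), re-run with radius and height as parameters. -/
theorem stub_femtoFloorUnit : __Registered.stub_femtoFloorUnit := by
  sorry

/-- stub (crux r5, L−; item 23204, two of three stubs landed): the torus Källén–Lehmann representation. OPEN. -/
theorem stub_torusKL : __Registered.stub_torusKL := by
  sorry

/-- stub (support, M): CHORD ESCALATOR — `TorusKL` at `(β, L, T = 2L+1, s)`, the `HasSum`s of `v`, `f₁ = v(· + (A′−1)Ns e₀)`,
`g = v(· + A′Ns e₀)` (`N = ⌊h₁/s⌋`, `A′ = ⌊(δ₁−hc)/(Ns)⌋ ≤ ⌈2δ₁/h₁⌉`), the reindexing `amp(shift by m) = μ^m · amp`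
(`tsum` over `ℤ⁴`, `Equiv.addRight`; `Int.toNat (x 0 − 1)` exact on heights `≥ s`), Jensen for `c_n ∝ W_n‖amp g‖²`, `t_n = μ_n²`,
`φ(t) = t^{A′}`: `Qrp(f₁)^{A′} ≤ Qrp(g)^{A′−1} Qrp(v)`, then `ε ≤ 1 ≤ C` monotonicity in the exponent. OPEN. -/
theorem stub_chordEscalator : __Registered.stub_chordEscalator := by
  sorry

/-- stub (support, M/L): FEMTO CEILING — `stub_collar6 : FBL6 → MomentBounds6` (landed), the SS ↔ `torusE`/`plane` dictionary of
Theorems/SqueezedSkewnessSeamFromMomentsProof.lean, `n = 2`, `R = min(⌊ℓ₄/a⌋, ⌊hc/a⌋ − 3)`, `(2ρ/a+2)⁸ · 36 · ‖v‖∞² · C₆²/R⁸`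
is `a`-uniform. OPEN. -/
theorem stub_femtoCeiling : __Registered.stub_femtoCeiling := by
  sorry

/-- stub (crux r2, XL; item 23201) — LINE α: the low-pass point floor with its infrared payment. OPEN. -/
theorem stub_lowPassFloorH : __Registered.stub_lowPassFloorH := by
  sorry

/-- stub (crux r3, L; item 23202, split into FloorUnitFBL6 23389 + AntipodalMixing 23390 + glue 23391 ✓) — LINE α. OPEN. -/
theorem stub_antipodalMirrorCeiling : __Registered.stub_antipodalMirrorCeiling := by
  sorry

/-- LINE α composition (kernel-checked, landed glue BY NAME): `LowPassFloorH → AntipodalMirrorCeiling → TorusKL →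
PointlikeHypercubeFloors` through `torusFloorsGlue_proof ✓`, `klCoherence_proof ✓`, `divisibleBump_proof ✓`. -/
theorem PointlikeHypercubeFloors_of_lowpass (h1 : __Registered.stub_lowPassFloorH)
    (h2 : __Registered.stub_antipodalMirrorCeiling) (h3 : __Registered.stub_torusKL) :
    Summit.QuantumFields.YangMills.Theses.SqueezedSkewness.PointlikeHypercubeFloors :=
  Summit.QuantumFields.YangMills.Theorems.SqueezedSkewnessTorusFloorsGlue.torusFloorsGlue_proof h1
    Summit.QuantumFields.YangMills.Theorems.KLCoherence.klCoherence_proof h3 h2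
    Summit.QuantumFields.YangMills.Theorems.SqueezedSkewnessDivisibleBump.divisibleBump_proof

/-- (unregistered, for the reuse remark) the floors-only form of the crux. [folklore] -/
def FemtoBumpFloors : Prop :=
  ∀ (G : Type) [Group G] [TopologicalSpace G] [IsTopologicalGroup G] [CompactSpace G], Literature.MathematicalPhysics.QuantumFieldTheory.IsCompactSimpleLieGroup G → letI : MeasurableSpace G := borel G; haveI : BorelSpace G := ⟨rfl⟩; ∃ (r : Literature.MathematicalPhysics.QuantumFieldTheory.LatticeRep G) (a : ℝ → ℝ), let St : ℕ → ℕ → Type := fun S T => Literature.MathematicalPhysics.QuantumFieldTheory.FinTorusSite S S S T; let Cfg : ℕ → ℕ → Type := fun S T => Literature.MathematicalPhysics.QuantumFieldTheory.FinTorusSite S S S T × Fin 4 → G; let cc : (n : ℕ) → Fin n → ℤ := fun n i => if 2 * i.val < n then (i.val : ℤ) else (i.val : ℤ) - n; let posE : (S T : ℕ) → St S T → EuclideanSpace ℝ (Fin 4) := fun S T x => Literature.MathematicalPhysics.QuantumLattice.siteToE (d := 4) ![cc T x.2.2.2, cc S x.1, cc S x.2.1, cc S x.2.2.1]; let P : (S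 T : ℕ) → St S T → Fin 4 → Fin 4 → Cfg S T → ℝ := fun _ _ x i j U => (r.ρ (Literature.MathematicalPhysics.QuantumFieldTheory.finTorusPlaquette U x i j)).trace.re; let A : (S T : ℕ) → St S T → Cfg S T → ℝ := fun S T x U => ∑ q : {q : Fin 4 × Fin 4 // q.1 < q.2}, P S T x q.1.1 q.1.2 U; let w : ℝ → (S T : ℕ) → Cfg S T → ℝ := fun β S T U => Real.exp (-β * ∑ x : St S T, ∑ q : {q : Fin 4 × Fin 4 // q.1 < q.2}, ((r.N : ℝ) - P S T x q.1.1 q.1.2 U)); let E : ℝ → (S T : ℕ) → (Cfg S T → ℝ) → ℝ := fun β S T F => (∫ U : Literature.MathematicalPhysics.QuantumFieldTheory.FinTorusSite S S S T × Fin 4 → G, F U * w β S T U ∂MeasureTheory.Measure.pi (fun _ => Literature.MathematicalPhysics.QuantumFieldTheory.haarProbability G)) / Literature.MathematicalPhysics.QuantumFieldTheory.wilsonFinTorusPartition r.ρ β S S S T; let Cov : ℝ → (S T : ℕ) → (Cfg S T → ℝ) → (Cfg S T → ℝ) → ℝ := fun β S T F F' => E β S T (fun U => F U * F' U) - E β S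 T F * E β S T F'; let refl : (S T : ℕ) → Cfg S T → Cfg S T := fun _ T U e => if e.2 = Fin.last 3 then (U ((e.1.1, e.1.2.1, e.1.2.2.1, Fin.rev e.1.2.2.2), Fin.last 3))⁻¹ else U ((e.1.1, e.1.2.1, e.1.2.2.1, ⟨(T - e.1.2.2.2.val) % T, Nat.mod_lt _ e.1.2.2.2.pos⟩), e.2); let B : (S T : ℕ) → ℝ → SchwartzMap (EuclideanSpace ℝ (Fin 4)) ℝ → Cfg S T → ℝ := fun S T s f U => ∑ x : St S T, f (s • posE S T x) * A S T x U; let Qrp : ℝ → (S T : ℕ) → ℝ → SchwartzMap (EuclideanSpace ℝ (Fin 4)) ℝ → ℝ := fun β S T s f => Cov β S T (fun U => B S T s f (refl S T U)) (B S T s f); (∀ β, 0 < a β) ∧ Filter.Tendsto a Filter.atTop (nhds 0) ∧ ∀ ρ : ℝ, 0 < ρ → ∃ (v : SchwartzMap (EuclideanSpace ℝ (Fin 4)) ℝ), (∀ x, 0 ≤ v x) ∧ tsupport (v : EuclideanSpace ℝ (Fin 4) → ℝ) ⊆ Metric.closedBall (EuclideanSpace.single (0 : Fin 4) (1 : ℝ))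 ρ ∧ ∃ (δ₁ δ₂ h₁ ε β₅ Λ₅ : ℝ), 0 < δ₁ ∧ tsupport v ⊆ {y : EuclideanSpace ℝ (Fin 4) | δ₁ < y 0 ∧ y 0 < δ₂} ∧ 0 < h₁ ∧ 3 * h₁ ≤ δ₁ ∧ 0 < ε ∧ ∀ β : ℝ, β₅ ≤ β → ∀ L : ℕ, Λ₅ ≤ a β * L → ∀ (τ : ℝ) (f : SchwartzMap (EuclideanSpace ℝ (Fin 4)) ℝ), h₁ ≤ δ₁ - τ → δ₁ - τ ≤ 3 * h₁ → (∀ y, f y = v (y + τ • EuclideanSpace.single (0 : Fin 4) (1 : ℝ))) → ε ≤ Qrp β (2 * L + 1) (2 * L + 1) (a β) f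

/-- Inner composition: `tsupport (f ∘ g) ⊆ g⁻¹(tsupport f)` for continuous `g`. [folklore] -/
theorem tsupport_comp_subset_preimage' {X Y M : Type*} [TopologicalSpace X] [TopologicalSpace Y]
    [Zero M] (f : Y → M) {g : X → Y} (hg : Continuous g) :
    tsupport (f ∘ g) ⊆ g ⁻¹' tsupport f :=
  closure_minimal (fun x hx => subset_closure (by simpa [Function.mem_support] using hx))
    ((isClosed_tsupport f).preimage hg)

/-- REUSE PATH (kernel-checked remark): the floors-only form plus LINE 1's shared crux `FloorUnitFBL6` (23389) give the
bundled crux — `FloorUnitFBL6`'s disjunct (ii) is fed with the FIXED translate of the bump at height `2h₁`. [folklore] -/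
theorem femtoFloorUnit_of_floors (h1 : FemtoBumpFloors) (h2 : FloorUnitFBL6) :
    __Registered.stub_femtoFloorUnit := by
  intro G i1 i2 i3 i4 hG
  letI : MeasurableSpace G := borel G
  haveI : BorelSpace G := ⟨rfl⟩
  obtain ⟨r, a, h1'⟩ := h1 G hG
  refine ⟨r, a, ?_⟩
  dsimp only at h1' ⊢
  obtain ⟨ha, ha0, hall⟩ := h1'
  refine ⟨ha, ha0, ?_, hall⟩
  obtain ⟨v, hv0, hball, δ₁, δ₂, h₁, ε, β₅, Λ₅, hδ₁, hslab, hh₁, h3h₁, hε, hfloor⟩ := hall 1 one_pos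
  have h2' := h2 G hG r a ha ha0
  dsimp only at h2'
  refine h2' (Or.inr ?_)
  set τ₀ : ℝ := δ₁ - 2 * h₁ with hτ₀
  obtain ⟨f₀, hf₀⟩ : ∃ f₀ : SchwartzMap (EuclideanSpace ℝ (Fin 4)) ℝ,
      ∀ y, f₀ y = v (y + τ₀ • EuclideanSpace.single (0 : Fin 4) (1 : ℝ)) :=
    ⟨SchwartzMap.compSubConstCLM ℝ (-(τ₀ • EuclideanSpace.single (0 : Fin 4) (1 : ℝ))) v, fun y => by
      simp [SchwartzMap.compSubConstCLM_apply, sub_neg_eq_add]⟩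
  have hcont : Continuous (fun y : EuclideanSpace ℝ (Fin 4) => y + τ₀ • EuclideanSpace.single (0 : Fin 4) (1 : ℝ)) :=
    continuous_id.add continuous_const
  have hfeq : (f₀ : EuclideanSpace ℝ (Fin 4) → ℝ) =
      (v : EuclideanSpace ℝ (Fin 4) → ℝ) ∘ (fun y : EuclideanSpace ℝ (Fin 4) => y + τ₀ • EuclideanSpace.single (0 : Fin 4) (1 : ℝ)) :=
    funext fun y => by simp [hf₀]
  refine ⟨f₀, 2 * h₁, δ₂ - τ₀, by positivity, ?_, ε, β₅, Λ₅, hε, fun β hβ L hL => ?_⟩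
  · intro y hy
    rw [hfeq] at hy
    have hy' := tsupport_comp_subset_preimage' (v : EuclideanSpace ℝ (Fin 4) → ℝ) hcont hy
    have hz := hslab hy'
    simp only [Set.mem_preimage, Set.mem_setOf_eq, PiLp.add_apply, PiLp.smul_apply,
      EuclideanSpace.single_apply, if_true, smul_eq_mul, mul_one] at hz
    simp only [Set.mem_setOf_eq]
    constructor <;> linarith [hz.1, hz.2]
  · exact hfloor β hβ L hL τ₀ f₀ (by linarith) (by linarith) hf₀

/-- COMPOSITION (kernel-checked, no sorry) = the route item `ChordFloorsGlue`:
`FemtoFloorUnit → TorusKL → ChordEscalator → FemtoCeiling → PointlikeHypercubeFloors`. [folklore] -/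
theorem PointlikeHypercubeFloors_of (h1 : __Registered.stub_femtoFloorUnit) (h3 : __Registered.stub_torusKL)
    (h4 : __Registered.stub_chordEscalator) (h5 : __Registered.stub_femtoCeiling) :
    Summit.QuantumFields.YangMills.Theses.SqueezedSkewness.PointlikeHypercubeFloors := by
  intro G i1 i2 i3 i4 hG
  letI : MeasurableSpace G := borel G
  haveI : BorelSpace G := ⟨rfl⟩
  obtain ⟨r, a, h1'⟩ := h1 G hG
  refine ⟨r, a, ?_⟩
  dsimp only at h1' ⊢
  obtain ⟨ha, ha0, hF6, hall⟩ := h1'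
  refine ⟨ha, ha0, fun ρ hρ => ?_⟩
  obtain ⟨v, hv0, hball, δ₁, δ₂, h₁, ε, β₅, Λ₅, hδ₁, hslab, hh₁, h3h₁, hε, hfloor⟩ := hall ρ hρ
  -- the femto ceiling of the unit (from `FBL6`)
  have h5' := h5 G hG r a ha ha0 hF6
  dsimp only at h5'
  obtain ⟨C, β₆, Λ₆, hceil⟩ := h5' v ρ δ₁ δ₂ h₁ hh₁ hball hslab
  -- the chord escalator of the hypercube (from `TorusKL`)
  have h4' := h4 h3 G hG r
  dsimp only at h4'
  -- thresholds: `a β ≤ min h₁ 1` eventually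
  obtain ⟨β₇, hβ₇⟩ : ∃ β₇ : ℝ, ∀ β, β₇ ≤ β → a β < min h₁ 1 := by
    have h1 : ∀ᶠ β in Filter.atTop, a β < min h₁ 1 :=
      ha0.eventually (gt_mem_nhds (lt_min hh₁ one_pos))
    exact Filter.eventually_atTop.mp h1
  refine ⟨v, hv0, hball, δ₁, δ₂, (min ε 1) ^ ⌈2 * δ₁ / h₁⌉₊ / (max C 1) ^ ⌈2 * δ₁ / h₁⌉₊,
    max β₅ (max β₆ (max β₇ 0)), max Λ₅ (max Λ₆ (ρ + |δ₂| + 1)), hδ₁, hslab, by positivity, ?_⟩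
  intro β hβ L hL
  simp only [max_le_iff] at hβ hL
  obtain ⟨hβ5, hβ6, hβ7, hβ0⟩ := hβ
  obtain ⟨hΛ5, hΛ6, hΛρ⟩ := hL
  have hs : 0 < a β := ha β
  have hsh : a β ≤ h₁ := (hβ₇ β hβ7).le.trans (min_le_left _ _)
  have hs1 : a β ≤ 1 := (hβ₇ β hβ7).le.trans (min_le_right _ _)
  have hL1 : 1 ≤ L := by
    have h1 : (1 : ℝ) ≤ a β * L := by linarith [abs_nonneg δ₂, hρ.le]
    have h2 : (1 : ℝ) ≤ (L : ℝ) := h1.trans (mul_le_of_le_one_left (Nat.cast_nonneg L) hs1)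
    exact_mod_cast h2
  have hwin : ρ + δ₂ + 1 ≤ a β * L := by linarith [le_abs_self δ₂]
  exact h4' β L (a β) v ρ δ₁ δ₂ h₁ h₁ (min ε 1) (max C 1) hβ0 hL1 hs hsh le_rfl h3h₁ hs1 hwin hball hslab
    (lt_min hε one_pos) (min_le_right _ _) (le_max_right _ _)
    (fun k f hk1 hk2 hf => (min_le_left _ _).trans (hfloor β hβ5 L hΛ5 (a β * k) f hk1 hk2 hf))
    (fun k g hk hg => (hceil β hβ6 L hΛ6 k g hk hg).trans (le_max_left _ _))

end Summit.QuantumFields.YangMills.Cruxes.NT.PointlikeNodeBirth
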